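import Summits.Ventures.PercRepro.Night4TrT2C2Q6M0Z
import Summits.Ventures.PercRepro.Night4TrT2C3Q6M0Z
import Summits.Ventures.PercRepro.Night4TrT2C4Q6M0Z
import Summits.Ventures.PercRepro.Night4TrT2C5Q6M0Z
import Summits.Ventures.PercRepro.Night4TrT2C6Q6M0Z
import Summits.Ventures.PercRepro.Night4TrT2C7Q6M0Z
import Summits.Ventures.PercRepro.Night4TrT2C8Q6M0Z
import Summits.Ventures.PercRepro.Night4TrT2C9Q6M0Z
import Summits.Ventures.PercRepro.Night4TrT2C10Q6M0Z
import Summits.Ventures.PercRepro.Night4TrT2C11Q6M0Z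
import Summits.Ventures.PercRepro.Night4TrT2C2Q6M1Z
import Summits.Ventures.PercRepro.Night4TrT2C3Q6M1Z
import Summits.Ventures.PercRepro.Night4TrT2C4Q6M1Z
import Summits.Ventures.PercRepro.Night4TrT2C5Q6M1Z
import Summits.Ventures.PercRepro.Night4TrT2C6Q6M1Z
import Summits.Ventures.PercRepro.Night4TrT2C7Q6M1Z
import Summits.Ventures.PercRepro.Night4TrT2C8Q6M1Z
import Summits.Ventures.PercRepro.Night4TrT2C9Q6M1Z
import Summits.Ventures.PercRepro.Night4TrT2C10Q6M1Z
import Summits.Ventures.PercRepro.Night4TrT2C11Q6M1Z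
import Summits.Ventures.PercRepro.Night4TrT2C2Q6M2Z
import Summits.Ventures.PercRepro.Night4TrT2C3Q6M2Z
import Summits.Ventures.PercRepro.Night4TrT2C4Q6M2Z
import Summits.Ventures.PercRepro.Night4TrT2C5Q6M2Z
import Summits.Ventures.PercRepro.Night4TrT2C6Q6M2Z
import Summits.Ventures.PercRepro.Night4TrT2C2Q6M3Z
import Summits.Ventures.PercRepro.Night4TrT2C3Q6M3Z
import Summits.Ventures.PercRepro.GenQTraceSevenAll
import Summits.Ventures.PercRepro.GenQTraceTopColoop
import Summits.Ventures.PercRepro.GenQEightSixTrace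

/-!
# PercRepro — the `(9, 7)` row: the trace residue at `t = 2` (night-4, gen 18)
`traceSix_residue_of_hyps_t2`: the `t = 2` block of the trace residue `TraceSixResidue` — the case split over the coloop count `m` and the corank `d` of the rank-`6` subset, one trace certificate `traceSum_nonneg_t2_c{d}_q6_m{m}` (two-level / shifted / top-coloop where the table says so) per case; gen 17's one-module assembly split into six under the 400-line cap, statements unchanged.
-/
namespace PercRepro.Night4

open Finset ThmH SixFour GenQ PerFlat Star NightThree ThmN

variable {α : Type} [DecidableEq α] {M : Matroid α} [M.Finite]

/-- **The trace residue at `t = 2`** (the `t = 2` block of `traceSix_residue_of_hyps`, split out under the 400-line cap): the rank-`6` subset `H` has `≤ m + fCore(6 − m)` points by its coloop count `m` (`card_le_mTr_add_of_flats`), `m ≥ 5` forces a basis (`card_eq_of_mTr_ge`); every other `(d, m)` a certificate. -/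
theorem traceSix_residue_of_hyps_t2 (hs : Simple M) (hline : ∀ L ∈ flatsQ M 2, L.card ≤ 3) (hplane : ∀ P ∈ flatsQ M 3, P.card ≤ 6) (hsolid : ∀ F ∈ flatsQ M 4, F.card ≤ 10) (hflat5 : ∀ F ∈ flatsQ M 5, F.card ≤ 21) (hflat6 : ∀ F ∈ flatsQ M 6, F.card ≤ 43) {H : Finset α} (hH : H ⊆ gr M) (hrH : M.eRk (H : Set α) = ((6 : ℕ) : ℕ∞)) (hlo : 6 + 2 ≤ H.card) (hhi : H.card < 18) : 0 ≤ ∑ B ∈ Rq M H 6, ((((6 + 1 : ℕ) : ℚ) + 2 - ((2 : ℕ) : ℚ)) * (1 / (2 + (mTr M B : ℚ))) - ((((6 + 1 : ℕ) : ℚ) + 2) / (((6 + 1 : ℕ) : ℚ) + 1)) * GenQ.dem M H 2 B) := by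
  have hm6 : mTr M H ≤ 6 := mTr_le_of_eRk_eq hH hrH
  obtain ⟨d, hd⟩ : ∃ d, H.card = 6 + d := ⟨H.card - 6, by omega⟩
  obtain ⟨m, hm⟩ : ∃ m, mTr M H = m := ⟨_, rfl⟩
  have hm6' : m ≤ 6 := hm ▸ hm6
  interval_cases m
  · -- m = 0
    have hsz : H.card ≤ 0 + 43 := card_le_mTr_add_of_flats (q := 6) (m := 0) hflat6 hH hrH hm
    have h1 : 2 ≤ d := by omega
    have h2 : d ≤ 11 := by omega
    interval_cases d
    · exact traceSum_nonneg_t2_c2_q6_m0 hs hline hplane hsolid hflat5 hflat6 hH hrH hd hm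
    · exact traceSum_nonneg_t2_c3_q6_m0 hs hline hplane hsolid hflat5 hflat6 hH hrH hd hm
    · exact traceSum_nonneg_t2_c4_q6_m0 hs hline hplane hsolid hflat5 hflat6 hH hrH hd hm
    · exact traceSum_nonneg_t2_c5_q6_m0 hs hline hplane hsolid hflat5 hflat6 hH hrH hd hm
    · exact traceSum_nonneg_t2_c6_q6_m0 hs hline hplane hsolid hflat5 hflat6 hH hrH hd hm
    · exact traceSum_nonneg_t2_c7_q6_m0 hs hline hplane hsolid hflat5 hflat6 hH hrH hd hm
    · exact traceSum_nonneg_t2_c8_q6_m0 hs hline hplane hsolid hflat5 hflat6 hH hrH hd hm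
    · exact traceSum_nonneg_t2_c9_q6_m0 hs hline hplane hsolid hflat5 hflat6 hH hrH hd hm
    · exact traceSum_nonneg_t2_c10_q6_m0 hs hline hplane hsolid hflat5 hflat6 hH hrH hd hm
    · exact traceSum_nonneg_t2_c11_q6_m0 hs hline hplane hsolid hflat5 hflat6 hH hrH hd hm
  · -- m = 1
    have hsz : H.card ≤ 1 + 21 := card_le_mTr_add_of_flats (q := 6) (m := 1) hflat5 hH hrH hm
    have h1 : 2 ≤ d := by omega
    have h2 : d ≤ 11 := by omega
    interval_cases d
    · exact traceSum_nonneg_t2_c2_q6_m1 hs hline hplane hsolid hflat5 hflat6 hH hrH hd hm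
    · exact traceSum_nonneg_t2_c3_q6_m1 hs hline hplane hsolid hflat5 hflat6 hH hrH hd hm
    · exact traceSum_nonneg_t2_c4_q6_m1 hs hline hplane hsolid hflat5 hflat6 hH hrH hd hm
    · exact traceSum_nonneg_t2_c5_q6_m1 hs hline hplane hsolid hflat5 hflat6 hH hrH hd hm
    · exact traceSum_nonneg_t2_c6_q6_m1 hs hline hplane hsolid hflat5 hflat6 hH hrH hd hm
    · exact traceSum_nonneg_t2_c7_q6_m1 hs hline hplane hsolid hflat5 hflat6 hH hrH hd hm
    · exact traceSum_nonneg_t2_c8_q6_m1 hs hline hplane hsolid hflat5 hflat6 hH hrH hd hm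
    · exact traceSum_nonneg_t2_c9_q6_m1 hs hline hplane hsolid hflat5 hflat6 hH hrH hd hm
    · exact traceSum_nonneg_t2_c10_q6_m1 hs hline hplane hsolid hflat5 hflat6 hH hrH hd hm
    · exact traceSum_nonneg_t2_c11_q6_m1 hs hline hplane hsolid hflat5 hflat6 hH hrH hd hm
  · -- m = 2
    have hsz : H.card ≤ 2 + 10 := card_le_mTr_add_of_flats (q := 6) (m := 2) hsolid hH hrH hm
    have h1 : 2 ≤ d := by omega
    have h2 : d ≤ 6 := by omega
    interval_cases d
    · exact traceSum_nonneg_t2_c2_q6_m2 hs hline hplane hsolid hflat5 hflat6 hH hrH hd hm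
    · exact traceSum_nonneg_t2_c3_q6_m2 hs hline hplane hsolid hflat5 hflat6 hH hrH hd hm
    · exact traceSum_nonneg_t2_c4_q6_m2 hs hline hplane hsolid hflat5 hflat6 hH hrH hd hm
    · exact traceSum_nonneg_t2_c5_q6_m2 hs hline hplane hsolid hflat5 hflat6 hH hrH hd hm
    · exact traceSum_nonneg_t2_c6_q6_m2 hs hline hplane hsolid hflat5 hflat6 hH hrH hd hm
  · -- m = 3
    have hsz : H.card ≤ 3 + 6 := card_le_mTr_add_of_flats (q := 6) (m := 3) hplane hH hrH hm
    have h1 : 2 ≤ d := by omega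
    have h2 : d ≤ 3 := by omega
    interval_cases d
    · exact traceSum_nonneg_t2_c2_q6_m3 hs hline hplane hsolid hflat5 hflat6 hH hrH hd hm
    · exact traceSum_nonneg_t2_c3_q6_m3 hs hline hplane hsolid hflat5 hflat6 hH hrH hd hm
  · -- m = 4
    have hsz : H.card ≤ 4 + 3 := card_le_mTr_add_of_flats (q := 6) (m := 4) hline hH hrH hm
    omega
  · -- m = 5
    have h0 := card_eq_of_mTr_ge (q := 6) (H := H) hs hH hrH (by norm_num) hd (by omega)
    omega
  · -- m = 6
    have h0 := card_eq_of_mTr_ge (q := 6) (H := H) hs hH hrH (by norm_num) hd (by omega)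
    omega

end PercRepro.Night4
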